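import Mathlib.LinearAlgebra.Matrix.Block
import Literature.AlgebraicGeometry.HilbertScheme.HilbertSchemeOfPoints
import Literature.AlgebraicGeometry.Hyperkaehler.OGradySixType
import Literature.AlgebraicGeometry.Surfaces.K3PeriodSurjectivity
import HarnessLib

/-!
# Hyperkähler manifolds of `K3^[n]`-type (`K3^[2]`-type) and the `K3^[n]` lattice `Λ_K3 ⊕ ⟨2 - 2n⟩`

Layer `Literature/AlgebraicGeometry/Hyperkaehler`. Definition item `defn-IsOfK3HilbertSquareType`
(crux `stmt-HodgeConjecture-13674`, line hyperkaehler-nikulin-anchors; also cruxes 14393/15067 and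
the Markman-type facts): "(1) the Hilbert scheme of `n` points `S^[n]` of a smooth projective surface
[…] representing the functor of length-`n` closed subschemes, with the universal family
`Ξ_n ⊂ S × S^[n]` — (2) `IsOfK3HilbertType n X : Prop :=` `X` is deformation equivalent
(`Hyperkaehler.AreDeformationEquivalent (2n)`) to `S₀^[n]` for some K3 surface `S₀`
(`Surfaces.IsK3Surface`), the deformation type "`K3^[n]`-type" of Markman, Mongardi,
Camere–Garbagnati–Kapustka–Kapustka — (3) the BBF lattice of `K3^[n]`-type as a marking target
`Λ_K3 ⊕ ⟨-2(n-1)⟩` (extend `Surfaces.K3Index` / `k3Gram` by one index)". Part (1) is the file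
`Literature/AlgebraicGeometry/HilbertScheme/HilbertSchemeOfPoints.lean` (Mathlib generality:
`HilbertScheme.IsHilbertSchemeOfPoints n X H Ξ`, "`(H, Ξ)` represents `Hilb^n_{X/B}`"); parts (2)
and (3) are this file.

## Sources (read; PDF pages of the materialised texts)

* A. Beauville, *Variétés kählériennes dont la première classe de Chern est nulle*, J. Differential
  Geom. 18 (1983), §6 p. 765 (PDF p. 11): "On notera `S^[r]` l'espace de Douady (ou schéma de
  Hilbert…) qui paramètre les sous-espaces analytiques finis `Z ⊂ S` avec `lg(𝒪_Z) = r`";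
  Prop. 6 (p. 768): "Soit `S` une surface K3, et `r` un entier `≥ 2`. Alors `S^[r]` est simplement
  connexe, il existe un homomorphisme injectif `i : H²(S, ℂ) → H²(S^[r], ℂ)`, compatible aux
  structures de Hodge, et on a `H²(S^[r], ℂ) = i(H²(S, ℂ)) ⊕ ℂ[E]`", with the Remarque
  "`H²(S^[r], ℤ) = i(H²(S, ℤ)) ⊕ ℤδ`, où `δ` est un élément de `H²(S^[r], ℤ)` tel que `2δ = [E]`";
  Théorème 3 (p. 768): "Soit `S` une surface K3 générique [every projective `S` is générique,
  loc. cit.]. Alors `S^[r]` est une variété kählérienne symplectique irréductible (simplement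
  connexe), de dimension `2r`"; §9 Lemme 1 and Remarque 1 (p. 778): "Normalisons `q` de façon que
  `q(i(α)) = α²`; on peut alors montrer qu'on a `q(e) = -8(r - 1)`" (`e = [E] = 2δ`, so
  `q(δ) = -2(r - 1) = 2 - 2r`, and `e ⟂ i(H²(S))` by Lemme 1) "… cela entraîne que `q` est la
  polarisation canonique de `H²(S^[r], ℂ)`" (the primitive integral Beauville–Bogomolov form).
* E. Markman, *Rational Hodge isometries of hyper-Kähler varieties of `K3^[n]` type are algebraic*,
  Compos. Math. 160 (2024) (arXiv:2204.00516), §1.1 (PDF p. 3), verbatim: "If `X` is a Kähler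
  manifold which is deformation equivalent to the Hilbert scheme `S^[n]` of length `n` subschemes of
  a K3 surface `S`, then `X` is an irreducible holomorphic symplectic manifold [Beauville 1983]. The
  latter are said to be of `K3^[n]`-type."; §1.3 Step 1 (PDF p. 7): "Let `L` be a lattice isometric
  to the second cohomology of a K3 surface. Let `Λ` be the orthogonal direct sum `L ⊕ ℤδ`, where
  `(δ, δ) = 2 - 2n`. Then `Λ` is isometric to the second cohomology of an irreducible holomorphic
  symplectic manifold `X` of `K3^[n]`-type endowed with the BBF-pairing [Beauville 1983]."
* G. Mongardi, *Symplectic involutions on deformations of `K3^[2]`*, Cent. Eur. J. Math. 10 (2012)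
  (arXiv:1107.2854): the deformation type "deformations of `K3^[2]`" = `K3^[2]`-type fourfolds.
* D. Huybrechts, *Lectures on K3 Surfaces*, Ch. 1 §3.3 (the K3 lattice `E₈(-1)^{⊕2} ⊕ U^{⊕3}`,
  the tree's `Surfaces.k3Gram`).

## Rendering (tree carriers) and design

* `IsOfK3HilbertType n X` — **`X` is of `K3^[n]`-type**: there are a K3 surface `S₀` over `ℂ`
  (`Surfaces.IsK3Surface S₀`: smooth projective, `H¹(𝒪) = 0`, trivial canonical bundle), a
  Hilbert scheme of `n` points of `S₀` — a `ℂ`-scheme `H` with a universal family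
  `Ξ ⊂ S₀ ×_ℂ H` representing `Hilb^n_{S₀/ℂ}` (`HilbertScheme.IsHilbertSchemeOfPoints n S₀ H Ξ`;
  this IS `S₀^[n]`, unique up to unique isomorphism, `IsHilbertSchemeOfPoints.exists_iso`) which is
  a smooth projective variety of dimension `2n` (`Motives.IsSmoothProjective (2 * n) H` — a THEOREM
  about `S₀^[n]`: projective by Grothendieck, Göttsche Thm. 1.1.2 / Nitsure Thm. 5.1; smooth
  irreducible of dimension `2n` by Fogarty, Beauville §6 (a)–(b); recorded as a clause so that the
  witness `H` comes with its algebraic geometry — properness, finite type, Hodge models — and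
  restricting nothing in the intended instance) — and `X` is deformation equivalent to `H` in
  dimension `2n` (`Hyperkaehler.AreDeformationEquivalent (2 * n) H X`: some analytifications `H^an`,
  `X^an` are connected by a chain of proper holomorphic submersions over connected bases). This is
  the planner's clause (2) and, for `X` smooth projective (so `X^an` is a compact Kähler manifold),
  exactly Markman's "`X` is of `K3^[n]`-type" — being irreducible holomorphic symplectic is then a
  CONSEQUENCE (Beauville, as quoted by Markman), not a clause, as for `IsOfOGradySixType`; a
  consumer who wants the printed hypothesis "projective IHSM of `K3^[n]`-type" with the IHS
  structure in hand conjoins `IsProjectiveIrreducibleSymplectic (2 * n) X`. SMOOTHNESS OF `X` is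
  NOT asserted by the predicate and should be stated alongside (`Motives.IsSmoothProjective (2 * n)
  X`, as every printed source does): `AreDeformationEquivalent` asks for an analytification of `X`
  in the sense of `IsAnalytification` (a homeomorphism from a complex manifold onto `X(ℂ)` making
  regular functions holomorphic), which a singular `X` with bijective normalisation also admits
  (module docstring of `NumberTheory/Transcendental/Analytification`: "for singular `X` the
  predicate is not the right notion").
* `IsOfK3HilbertSquareType X := IsOfK3HilbertType 2 X` (the item's notion: `K3^[2]`-type
  fourfolds, "deformations of `K3^[2]`").
* HONEST, not a reference pattern. Contrast `OGradySixType.lean`, where O'Grady's `K̃_v` cannot be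
  named and statements quantify over a hypothesis structure `OGradySixReference` (so that lemmas
  over-generalise to hypothetical exotic types with the same invariants — the item's complaint):
  here the model `S₀^[n]` IS named by its universal property, so `IsOfK3HilbertType n` is inhabited
  by the `K3^[n]` deformation class and nothing else. Junk analysis: the class is non-empty by
  Grothendieck's existence theorem for `S₀^[n]` (`S₀` projective; a theorem ABOUT
  `IsHilbertSchemeOfPoints`, see that file's "Not here") together with `of_hodgeModel` below; were
  no Hilbert scheme to exist the predicate would be `False` (safe side). `∃ S₀` (the printed "a K3
  surface `S`") equals `∀ S₀` up to the theorems that all complex K3 surfaces are deformation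
  equivalent (Kodaira) and that `S ↦ S^[n]` takes families to families (the relative Douady space,
  Beauville §9: "Les variétés `S_b^[r]` s'organisent en un espace de Douady relatif, lisse au-dessus
  de `B`"). Small `n`: `S^[1] = S` (so `K3^[1]`-type = deformations of a projective K3 surface = K3
  surfaces, Kodaira), `S^[0] = pt`.
* THE `K3^[n]` LATTICE: `K3HilbertIndex = Surfaces.K3Index ⊕ Unit` (23 indices) and
  `k3HilbertGram n = Surfaces.k3Gram ⊕ (2 - 2n)` (block-diagonal), `k3HilbertForm n` its
  `ℂ`-bilinear extension — the abstract lattice `Λ_K3 ⊕ ⟨2 - 2n⟩ = E₈(-1)^{⊕2} ⊕ U^{⊕3} ⊕ ⟨2 - 2n⟩`,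
  for `n ≥ 2` the isometry class of `(H²(X, ℤ), q_X)` for `X` of `K3^[n]`-type (Beauville §9
  Rem. 1 with §6 Rem.; Markman §1.3); `n = 2`: `Λ_K3 ⊕ ⟨-2⟩`. For `n = 1` the extra block is `0`
  (documented junk: the lattice of a K3 surface is `k3Gram` itself), for `n = 0` it is `⟨2⟩`.

## API (all proved)

`isOfK3HilbertType_iff`, `isOfK3HilbertSquareType_iff` (unfolding);
`IsOfK3HilbertType.of_areDeformationEquivalent_self` and `.of_hodgeModel` (**`S₀^[n]` itself is of
`K3^[n]`-type** as soon as it carries a Hodge model — non-vacuity modulo the existence and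
smoothness of `S₀^[n]`), `.exists_isK3Surface`, `.exists_isSmoothProjective` (the smooth projective
model `H = S₀^[n]` with `IsProper H.hom` and `LocallyOfFiniteType H.hom`); the Gram matrix entries
`k3HilbertGram_inl_inl/…/inr_inr`,
`k3HilbertGram_two_inr_inr` (`δ² = -2` for `n = 2`), `k3HilbertGram_transpose` (symmetry),
`k3HilbertGram_diag_even` (the lattice is even), `card_k3HilbertIndex` (rank `23`),
`k3HilbertForm_inl` (restricts to `k3Form` on `Λ_K3`), `k3HilbertForm_delta` (`(δ.δ) = 2 - 2n`),
`k3HilbertForm_inl_delta` (`Λ_K3 ⟂ δ`).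

## Not here (each a theorem to be cited AGAINST these definitions; no named facts are introduced)

Existence, projectivity and smoothness of `S^[n]` (Grothendieck; Fogarty); Beauville's Théorème 3
(`S^[n]` is a projective irreducible symplectic variety of dimension `2n`, `b₂ = 23`) and the
isometry `(H²(S^[n], ℤ), q) ≅ Λ_K3 ⊕ ⟨2 - 2n⟩` with the canonical inclusion
`i : H²(S) ↪ H²(S^[n])` (the incidence correspondence through `Ξ`, isometric onto `δ^⊥`; needs the
cycle class of the universal family / the Hilbert–Chow morphism); markings and the period map /
Torelli / monodromy for `K3^[n]`-type (Markman); Mongardi's and Camere–Garbagnati–Kapustka–Kapustka's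
theorems on symplectic involutions of `K3^[2]`-type fourfolds; transitivity of
`AreDeformationEquivalent` (hence "of `K3^[n]`-type is closed under deformation"), which needs the
uniqueness of analytifications (`IsAnalytification.unique`, a named fact of the tree).
-/

noncomputable section

open CategoryTheory MonoidalCategory
open Literature.AlgebraicGeometry.HilbertScheme

namespace Literature.AlgebraicGeometry.Hyperkaehler

/-! ### Manifolds of `K3^[n]`-type -/

/-- **`X` is of `K3^[n]`-type** (Markman 2024 §1.1: "If `X` is a Kähler manifold which is
deformation equivalent to the Hilbert scheme `S^[n]` of length `n` subschemes of a K3 surface `S`,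
then `X` is an irreducible holomorphic symplectic manifold. The latter are said to be of
`K3^[n]`-type"; Beauville 1983 §6 Théorème 3 for `S^[r]`). For a `ℂ`-scheme `X`: there are a K3
surface `S₀` (`Surfaces.IsK3Surface`), a Hilbert scheme of `n` points `(H, Ξ)` of `S₀` over `ℂ`
(`HilbertScheme.IsHilbertSchemeOfPoints n S₀ H Ξ`, i.e. `H = S₀^[n]` with its universal family),
smooth projective of dimension `2n` (`Motives.IsSmoothProjective (2 * n) H`: Grothendieck's
projectivity and Fogarty's smoothness of `S₀^[n]`, Beauville §6 (a)–(b) — a theorem about the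
witness, recorded so that it comes with its algebraic geometry), and a deformation equivalence
between `H` and `X` in dimension `2n` (`AreDeformationEquivalent (2 * n) H X`). No IHS clause and
no smoothness clause ON `X` (consequence, resp. companion hypothesis, loc. cit.); see the module
docstring for the reading, `∃ S₀ = ∀ S₀`, and small `n`.
[cite: Markman2024, §1.1] [cite: Beauville1983, §6 Théorème 3 and propriétés (a)–(b)]
[cite: Nitsure2005, Thm. 5.1] -/
def IsOfK3HilbertType (n : ℕ) (X : Motives.SchemeOver ℂ) : Prop :=
  ∃ (S₀ H : Motives.SchemeOver ℂ) (Ξ : (S₀ ⊗ H).left.IdealSheafData),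
    Surfaces.IsK3Surface S₀ ∧ IsHilbertSchemeOfPoints n S₀ H Ξ ∧
      Motives.IsSmoothProjective (2 * n) H ∧ AreDeformationEquivalent (2 * n) H X

/-- **`X` is of `K3^[2]`-type** ("deformations of `K3^[2]`", Mongardi; Markman's `K3^[n]`-type for
`n = 2`): `X` is deformation equivalent, in dimension `4`, to the Hilbert square `S₀^[2]` of a K3
surface `S₀`. [cite: Mongardi2011, §1] [cite: Markman2024, §1.1] -/
abbrev IsOfK3HilbertSquareType (X : Motives.SchemeOver ℂ) : Prop :=
  IsOfK3HilbertType 2 X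

variable {n : ℕ} {X : Motives.SchemeOver ℂ}

/-- Unfolding lemma. [cite: Markman2024, §1.1] -/
theorem isOfK3HilbertType_iff : IsOfK3HilbertType n X ↔
    ∃ (S₀ H : Motives.SchemeOver ℂ) (Ξ : (S₀ ⊗ H).left.IdealSheafData),
      Surfaces.IsK3Surface S₀ ∧ IsHilbertSchemeOfPoints n S₀ H Ξ ∧
        Motives.IsSmoothProjective (2 * n) H ∧ AreDeformationEquivalent (2 * n) H X :=
  Iff.rfl

/-- Unfolding lemma for `K3^[2]`-type (dimension `2 · 2 = 4`). [cite: Mongardi2011, §1] -/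
theorem isOfK3HilbertSquareType_iff : IsOfK3HilbertSquareType X ↔
    ∃ (S₀ H : Motives.SchemeOver ℂ) (Ξ : (S₀ ⊗ H).left.IdealSheafData),
      Surfaces.IsK3Surface S₀ ∧ IsHilbertSchemeOfPoints 2 S₀ H Ξ ∧
        Motives.IsSmoothProjective 4 H ∧ AreDeformationEquivalent 4 H X :=
  Iff.rfl

namespace IsOfK3HilbertType

/-- **The Hilbert scheme `S₀^[n]` of a K3 surface is of `K3^[n]`-type** as soon as it is smooth
projective of dimension `2n` and deformation equivalent to itself (which holds once it carries a
Hodge model, `of_hodgeModel`). [cite: Beauville1983, §6 Théorème 3] -/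
theorem of_areDeformationEquivalent_self {S₀ H : Motives.SchemeOver ℂ}
    {Ξ : (S₀ ⊗ H).left.IdealSheafData} (hS : Surfaces.IsK3Surface S₀)
    (hH : IsHilbertSchemeOfPoints n S₀ H Ξ) (hHs : Motives.IsSmoothProjective (2 * n) H)
    (hself : AreDeformationEquivalent (2 * n) H H) : IsOfK3HilbertType n H :=
  ⟨S₀, H, Ξ, hS, hH, hHs, hself⟩

/-- **Non-vacuity (modulo existence and smoothness of `S₀^[n]`)**: a smooth projective Hilbert
scheme of `n` points of a K3 surface, of dimension `2n` (Grothendieck–Fogarty for `S₀^[n]`),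
carrying a Hodge model is of `K3^[n]`-type — by the constant family over a point,
`areDeformationEquivalent_self` (`H` is proper, being projective:
`Motives.IsProjectiveOver.isProper`). [cite: Beauville1983, §6 Théorème 3]
[cite: Kodaira2005, §2.3 (trivial family)] -/
theorem of_hodgeModel {S₀ H : Motives.SchemeOver ℂ} {Ξ : (S₀ ⊗ H).left.IdealSheafData}
    (hS : Surfaces.IsK3Surface S₀) (hH : IsHilbertSchemeOfPoints n S₀ H Ξ)
    (hHs : Motives.IsSmoothProjective (2 * n) H) (A : HodgeTheory.HodgeModel (2 * n) H) :
    IsOfK3HilbertType n H :=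
  haveI : AlgebraicGeometry.IsProper H.hom := hHs.isProjectiveOver.isProper
  of_areDeformationEquivalent_self hS hH hHs (areDeformationEquivalent_self A)

/-- A manifold of `K3^[n]`-type comes with a (projective) K3 surface. [cite: Markman2024, §1.1] -/
theorem exists_isK3Surface (h : IsOfK3HilbertType n X) :
    ∃ S₀ : Motives.SchemeOver ℂ, Surfaces.IsK3Surface S₀ := by
  obtain ⟨S₀, -, -, hS, -, -, -⟩ := h
  exact ⟨S₀, hS⟩

/-- A manifold of `K3^[n]`-type is deformation equivalent to a Hilbert scheme of `n` points of a K3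
surface (symmetric form of the definition). [cite: Markman2024, §1.1] -/
theorem exists_areDeformationEquivalent (h : IsOfK3HilbertType n X) :
    ∃ (S₀ H : Motives.SchemeOver ℂ) (Ξ : (S₀ ⊗ H).left.IdealSheafData),
      Surfaces.IsK3Surface S₀ ∧ IsHilbertSchemeOfPoints n S₀ H Ξ ∧
        Motives.IsSmoothProjective (2 * n) H ∧ AreDeformationEquivalent (2 * n) X H := by
  obtain ⟨S₀, H, Ξ, hS, hH, hHs, hd⟩ := h
  exact ⟨S₀, H, Ξ, hS, hH, hHs, hd.symm⟩

/-- The model `H = S₀^[n]` of a manifold of `K3^[n]`-type is proper and locally of finite type over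
`ℂ` (it is smooth projective) — the hypotheses under which the representing pair `(H, Ξ)` also
satisfies the finite-type-test-scheme formulation `ModuliOfSheaves.IsHilbertSchemeOfPoints` of the
tree (see `HilbertScheme/ModuliOfSheavesComparison`). [cite: Nitsure2005, Thm. 5.1]
[cite: Beauville1983, §6 propriétés (a)–(b)] -/
theorem exists_isSmoothProjective (h : IsOfK3HilbertType n X) :
    ∃ (S₀ H : Motives.SchemeOver ℂ) (Ξ : (S₀ ⊗ H).left.IdealSheafData),
      Surfaces.IsK3Surface S₀ ∧ IsHilbertSchemeOfPoints n S₀ H Ξ ∧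
        Motives.IsSmoothProjective (2 * n) H ∧ AlgebraicGeometry.IsProper H.hom ∧
          AlgebraicGeometry.LocallyOfFiniteType H.hom ∧ AreDeformationEquivalent (2 * n) H X := by
  obtain ⟨S₀, H, Ξ, hS, hH, hHs, hd⟩ := h
  haveI := hHs.smoothOfRelativeDimension
  haveI : AlgebraicGeometry.Smooth H.hom := AlgebraicGeometry.SmoothOfRelativeDimension.smooth (2 * n) _
  exact ⟨S₀, H, Ξ, hS, hH, hHs, hHs.isProjectiveOver.isProper, inferInstance, hd⟩

end IsOfK3HilbertType

/-! ### The `K3^[n]` lattice `Λ_K3 ⊕ ⟨2 - 2n⟩` -/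

/-- Index set of a basis of the `K3^[n]` lattice `Λ_K3 ⊕ ℤδ`: the `22` indices of the K3 lattice
(`Surfaces.K3Index`) and one more for `δ` (`2δ = [E]`, the class of the exceptional divisor of
`S^[n] → S^(n)`, Beauville §6 Rem.). [cite: Beauville1983, §6 Proposition 6 and Remarque]
[cite: Markman2024, §1.3 Step 1] -/
abbrev K3HilbertIndex : Type := Surfaces.K3Index ⊕ Unit

/-- **Gram matrix of the `K3^[n]` lattice** `Λ_K3 ⊕ ⟨2 - 2n⟩ = E₈(-1)^{⊕2} ⊕ U^{⊕3} ⊕ ⟨2 - 2n⟩`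
in the basis `K3HilbertIndex`: block-diagonal with blocks `Surfaces.k3Gram` and the `1 × 1` block
`(2 - 2n)` (Markman §1.3: "`Λ = L ⊕ ℤδ`, where `(δ, δ) = 2 - 2n` […] is isometric to the second
cohomology of an IHSM of `K3^[n]`-type endowed with the BBF-pairing"; Beauville §9 Rem. 1:
`q(e) = -8(r - 1)` for `e = 2δ`). Meaningful for `n ≥ 2`; for `n = 1` the block is `0` (junk — a
K3 surface has lattice `k3Gram`). [cite: Markman2024, §1.3 Step 1]
[cite: Beauville1983, §9 Lemme 1 and Remarque 1] -/
def k3HilbertGram (n : ℕ) : Matrix K3HilbertIndex K3HilbertIndex ℤ :=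
  Matrix.fromBlocks Surfaces.k3Gram 0 0 (Matrix.of fun _ _ => 2 - 2 * (n : ℤ))

/-- The `Λ_K3` block. [cite: Markman2024, §1.3 Step 1] -/
theorem k3HilbertGram_inl_inl (n : ℕ) (i j : Surfaces.K3Index) :
    k3HilbertGram n (Sum.inl i) (Sum.inl j) = Surfaces.k3Gram i j := rfl

/-- The `δ` block: `(δ, δ) = 2 - 2n`. [cite: Markman2024, §1.3 Step 1] -/
theorem k3HilbertGram_inr_inr (n : ℕ) (a b : Unit) :
    k3HilbertGram n (Sum.inr a) (Sum.inr b) = 2 - 2 * (n : ℤ) := rfl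

/-- `Λ_K3 ⟂ δ`. [cite: Beauville1983, §9 Lemme 1] -/
theorem k3HilbertGram_inl_inr (n : ℕ) (i : Surfaces.K3Index) (a : Unit) :
    k3HilbertGram n (Sum.inl i) (Sum.inr a) = 0 := rfl

/-- `δ ⟂ Λ_K3`. [cite: Beauville1983, §9 Lemme 1] -/
theorem k3HilbertGram_inr_inl (n : ℕ) (a : Unit) (i : Surfaces.K3Index) :
    k3HilbertGram n (Sum.inr a) (Sum.inl i) = 0 := rfl

/-- For `K3^[2]`-type the extra generator has square `-2`: the lattice is `Λ_K3 ⊕ ⟨-2⟩`.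
[cite: Mongardi2011, §2 Example 2.2] [cite: Markman2024, §1.3 Step 1] -/
theorem k3HilbertGram_two_inr_inr (a b : Unit) :
    k3HilbertGram 2 (Sum.inr a) (Sum.inr b) = -2 := rfl

/-- The Gram matrix is symmetric. [folklore] -/
theorem k3HilbertGram_transpose (n : ℕ) : (k3HilbertGram n).transpose = k3HilbertGram n := by
  rw [k3HilbertGram, Matrix.fromBlocks_transpose, Surfaces.k3Gram_transpose, Matrix.transpose_zero]
  congr 1

/-- The `K3^[n]` lattice has rank `22 + 1 = 23` (`= b₂` of a manifold of `K3^[n]`-type, `n ≥ 2`).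
[cite: Beauville1983, §6 Proposition 6] -/
theorem card_k3HilbertIndex : Fintype.card K3HilbertIndex = 23 := by
  simp [K3HilbertIndex, Surfaces.K3Index]

/-- The `K3^[n]` lattice is even (diagonal Gram entries are even: `-2` on the `E₈(-1)` blocks, `0`
on the hyperbolic planes, `2 - 2n`). [folklore] -/
theorem k3HilbertGram_diag_even (n : ℕ) (i : K3HilbertIndex) : Even (k3HilbertGram n i i) := by
  rcases i with i | a
  · rw [k3HilbertGram_inl_inl]
    revert i
    decide
  · rw [k3HilbertGram_inr_inr]
    exact ⟨1 - n, by ring⟩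

/-- The `ℂ`-bilinear extension `(a.b) = aᵀ G b` of the `K3^[n]` lattice form to
`Λ ⊗ ℂ = ℂ²³` (the marking target for `H²(X; ℂ)`, `X` of `K3^[n]`-type, as `Surfaces.k3Form` is
for K3 surfaces). [cite: Markman2024, §1.3 Step 1] -/
def k3HilbertForm (n : ℕ) (a b : K3HilbertIndex → ℂ) : ℂ :=
  ∑ i, ∑ j, a i * (k3HilbertGram n i j : ℂ) * b j

/-- Unfolding lemma. [cite: Markman2024, §1.3 Step 1] -/
theorem k3HilbertForm_apply (n : ℕ) (a b : K3HilbertIndex → ℂ) :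
    k3HilbertForm n a b = ∑ i, ∑ j, a i * (k3HilbertGram n i j : ℂ) * b j := rfl

/-- On vectors supported on the `Λ_K3` summand the form is the K3 form `Surfaces.k3Form`.
[cite: Beauville1983, §9 Lemme 1] -/
theorem k3HilbertForm_inl (n : ℕ) (a b : Surfaces.K3Index → ℂ) :
    k3HilbertForm n (Sum.elim a 0) (Sum.elim b 0) = Surfaces.k3Form a b := by
  simp [k3HilbertForm, Surfaces.k3Form, Fintype.sum_sum_type, k3HilbertGram_inl_inl]

/-- The extra generator `δ` has square `(δ.δ) = 2 - 2n`. [cite: Markman2024, §1.3 Step 1] -/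
theorem k3HilbertForm_delta (n : ℕ) :
    k3HilbertForm n (Sum.elim 0 1) (Sum.elim 0 1) = 2 - 2 * (n : ℂ) := by
  simp [k3HilbertForm, Fintype.sum_sum_type, k3HilbertGram_inr_inr]

/-- `δ` is orthogonal to the `Λ_K3` summand. [cite: Beauville1983, §9 Lemme 1] -/
theorem k3HilbertForm_inl_delta (n : ℕ) (a : Surfaces.K3Index → ℂ) :
    k3HilbertForm n (Sum.elim a 0) (Sum.elim 0 1) = 0 := by
  simp [k3HilbertForm, Fintype.sum_sum_type, k3HilbertGram_inl_inr]

end Literature.AlgebraicGeometry.Hyperkaehler
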